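import Summits.MatrixMultiplication.OmegaCensus.SmallFormats.MatMul22nPairingCR
import Summits.MatrixMultiplication.OmegaCensus.SmallFormats.MatMul22nDoubleCellKill
import HarnessLib

/-!
# ω-census family (a): the (R,R) and (C,C) entries of `Q` are `±` point pairings (`𝔽₃`)

Cell `pub-omega` (unit `pub-omega-tensor`, gen 40), topic `Summits/MatrixMultiplication/OmegaCensus` (sub-folder
`SmallFormats`). Framing (verbatim): lottery ticket; floor = certified bounds/negative ranges. HONEST FRAMING: M1-LEAN-BLUEPRINT F6 glue, types (R s, R t) and
(C s, C t) («F6 DESIGN»), companions of `PairingCR.Q_eq_pair_or_neg`: `PairingRR.Q_eq_pair_or_neg` (W_s rank one on `n⋆`, G_t = A-combos with `det A ≠ 0`;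
directions: `ω ⊥ ν_d` from cheapness of `s` for a row `d` met by `n⋆`, `A u' ⊥ ν_e` from cheapness of `t` for the column `e` whose plane contains `n⋆`) and
`PairingCC.Q_eq_pair_or_neg` (G_t rank one on `c⋆`, W_s = Ω-combos with `det Ω ≠ 0`; directions dually). Nothing here is a bound on `ω`.
-/

namespace Summit.MatrixMultiplication.OmegaCensus.SmallFormats

open Finset Matrix
open Literature.Computability.AlgebraicComplexity
open Summit.MatrixMultiplication.OmegaCensus.RankOnePlaneCapGeneral

variable {ι : Type*} [Fintype ι] {n : ℕ}

namespace PairingRR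

/-- **(R, R) entry.** -/
theorem Q_eq_pair_or_neg (β : BilinComp (mulBilin (ZMod 3) 2 2 n) ι) (Y : Matrix (Fin 2) (Fin 2) (ZMod 3)) (s t : ι)
    (nstar : Fin n → ZMod 3) (ω : Fin 2 → ZMod 3) (hW : ∀ p, β.w s p = ω p • nstar) (hω : ω ≠ 0)
    (c : Fin 2 → (Fin n → ZMod 3)) (A : Matrix (Fin 2) (Fin 2) (ZMod 3))
    (hG : ∀ q, (fun jj => β.g t (Matrix.single q jj (1 : ZMod 3))) = ∑ l, A q l • c l) (hA : A.det ≠ 0) (hu : ∃ l, nstar ⬝ᵥ c l ≠ 0)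
    (b : Fin 2 → (Fin n → ZMod 3)) (y : Fin 2 → ZMod 3) (hnb : nstar = ∑ l, y l • b l)
    (e : Fin 4) (hcheapG : ∀ m, β.g t (Matrix.vecMulVec (![-((![![1, 0], ![0, 1], ![1, 1], ![1, 2]] : Fin 4 → Fin 2 → ZMod 3) e 1), (![![1, 0], ![0, 1], ![1, 1], ![1, 2]] : Fin 4 → Fin 2 → ZMod 3) e 0] : Fin 2 → ZMod 3) (b m)) = 0)
    (cd : Fin 2 → (Fin n → ZMod 3)) (d : Fin 4) (hcheapW : ∀ m, ∑ i, cd m i * (Matrix.vecMul (![-((![![1, 0], ![0, 1], ![1, 1], ![1, 2]] : Fin 4 → Fin 2 → ZMod 3) d 1), (![![1, 0], ![0, 1], ![1, 1], ![1, 2]] : Fin 4 → Fin 2 → ZMod 3) d 0] : Fin 2 → ZMod 3) (β.w s)) i = 0)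
    (hnd : ∃ m, nstar ⬝ᵥ cd m ≠ 0) :
    (∑ p, ∑ q, Y q p * (β.w s p ⬝ᵥ (fun jj => β.g t (Matrix.single q jj (1 : ZMod 3))))) = ∑ p, ∑ q, Y q p * ((![![1, 0], ![0, 1], ![1, 1], ![1, 2]] : Fin 4 → Fin 2 → ZMod 3) d p * (![![1, 0], ![0, 1], ![1, 1], ![1, 2]] : Fin 4 → Fin 2 → ZMod 3) e q) ∨
    (∑ p, ∑ q, Y q p * (β.w s p ⬝ᵥ (fun jj => β.g t (Matrix.single q jj (1 : ZMod 3))))) = -∑ p, ∑ q, Y q p * ((![![1, 0], ![0, 1], ![1, 1], ![1, 2]] : Fin 4 → Fin 2 → ZMod 3) d p * (![![1, 0], ![0, 1], ![1, 1], ![1, 2]] : Fin 4 → Fin 2 → ZMod 3) e q) := by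
  classical
  -- β-vector: gv q := n⋆ ⬝ G_t q = (A u') q
  set u' : Fin 2 → ZMod 3 := fun l => nstar ⬝ᵥ c l with hu'
  have hmv : ∀ q, Matrix.mulVec A u' q = A q 0 * (nstar ⬝ᵥ c 0) + A q 1 * (nstar ⬝ᵥ c 1) := by
    intro q; simp [Matrix.mulVec, dotProduct, Fin.sum_univ_two, hu']
  have hgv : ∀ q, nstar ⬝ᵥ (fun jj => β.g t (Matrix.single q jj (1 : ZMod 3))) = Matrix.mulVec A u' q := by
    intro q
    rw [hG q, Fin.sum_univ_two, dotProduct_add, dotProduct_smul, dotProduct_smul, smul_eq_mul, smul_eq_mul, hmv q]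
  have hpair : ∀ p q, β.w s p ⬝ᵥ (fun jj => β.g t (Matrix.single q jj (1 : ZMod 3))) = ω p * Matrix.mulVec A u' q := by
    intro p q; rw [hW p, smul_dotProduct, smul_eq_mul, hgv q]
  have hu'0 : u' ≠ 0 := by
    obtain ⟨l, hl⟩ := hu
    exact Function.ne_iff.mpr ⟨l, by rw [hu']; exact hl⟩
  have hβ0 : Matrix.mulVec A u' ≠ 0 := fun h => hu'0 (Matrix.eq_zero_of_mulVec_eq_zero hA h)
  -- β ⊥ ν_e : from the cheapness of t for column e and n⋆ ∈ span(b)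
  have hβν : (![-((![![1, 0], ![0, 1], ![1, 1], ![1, 2]] : Fin 4 → Fin 2 → ZMod 3) e 1), (![![1, 0], ![0, 1], ![1, 1], ![1, 2]] : Fin 4 → Fin 2 → ZMod 3) e 0] : Fin 2 → ZMod 3) ⬝ᵥ Matrix.mulVec A u' = 0 := by
    have hq : ∀ m, (∑ κ, (![-((![![1, 0], ![0, 1], ![1, 1], ![1, 2]] : Fin 4 → Fin 2 → ZMod 3) e 1), (![![1, 0], ![0, 1], ![1, 1], ![1, 2]] : Fin 4 → Fin 2 → ZMod 3) e 0] : Fin 2 → ZMod 3) κ • (fun jj => β.g t (Matrix.single κ jj (1 : ZMod 3)))) ⬝ᵥ b m = 0 := by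
      intro m; rw [← DoubleCellKill.g_vecMulVec_eq_combo_dot]; exact hcheapG m
    have hn : (∑ κ, (![-((![![1, 0], ![0, 1], ![1, 1], ![1, 2]] : Fin 4 → Fin 2 → ZMod 3) e 1), (![![1, 0], ![0, 1], ![1, 1], ![1, 2]] : Fin 4 → Fin 2 → ZMod 3) e 0] : Fin 2 → ZMod 3) κ • (fun jj => β.g t (Matrix.single κ jj (1 : ZMod 3)))) ⬝ᵥ nstar = 0 := by
      rw [hnb, dotProduct_add_of_two y b, hq 0, hq 1]; ring
    -- (∑ ν κ • G κ) ⬝ n⋆ = ∑ κ ν κ (n⋆ ⬝ G κ) = ν ⬝ (A u')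
    rw [Fin.sum_univ_two, add_dotProduct, smul_dotProduct, smul_dotProduct, dotProduct_comm _ nstar, dotProduct_comm _ nstar,
      hgv 0, hgv 1, smul_eq_mul, smul_eq_mul] at hn
    rw [dotProduct, Fin.sum_univ_two]
    exact hn
  -- α = ω ⊥ ν_d : from the cheapness of s for row d
  have hαν : (![-((![![1, 0], ![0, 1], ![1, 1], ![1, 2]] : Fin 4 → Fin 2 → ZMod 3) d 1), (![![1, 0], ![0, 1], ![1, 1], ![1, 2]] : Fin 4 → Fin 2 → ZMod 3) d 0] : Fin 2 → ZMod 3) ⬝ᵥ ω = 0 := by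
    obtain ⟨m, hm⟩ := hnd
    have h := hcheapW m
    have h1 : ∑ i, cd m i * (Matrix.vecMul (![-((![![1, 0], ![0, 1], ![1, 1], ![1, 2]] : Fin 4 → Fin 2 → ZMod 3) d 1), (![![1, 0], ![0, 1], ![1, 1], ![1, 2]] : Fin 4 → Fin 2 → ZMod 3) d 0] : Fin 2 → ZMod 3) (β.w s)) i = ((![-((![![1, 0], ![0, 1], ![1, 1], ![1, 2]] : Fin 4 → Fin 2 → ZMod 3) d 1), (![![1, 0], ![0, 1], ![1, 1], ![1, 2]] : Fin 4 → Fin 2 → ZMod 3) d 0] : Fin 2 → ZMod 3) ⬝ᵥ ω) * (nstar ⬝ᵥ cd m) := by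
      have h2 : ∑ i, cd m i * (Matrix.vecMul (![-((![![1, 0], ![0, 1], ![1, 1], ![1, 2]] : Fin 4 → Fin 2 → ZMod 3) d 1), (![![1, 0], ![0, 1], ![1, 1], ![1, 2]] : Fin 4 → Fin 2 → ZMod 3) d 0] : Fin 2 → ZMod 3) (β.w s)) i = (![-((![![1, 0], ![0, 1], ![1, 1], ![1, 2]] : Fin 4 → Fin 2 → ZMod 3) d 1), (![![1, 0], ![0, 1], ![1, 1], ![1, 2]] : Fin 4 → Fin 2 → ZMod 3) d 0] : Fin 2 → ZMod 3) ⬝ᵥ Matrix.mulVec (β.w s) (cd m) := by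
        rw [Matrix.dotProduct_mulVec, dotProduct_comm]; rfl
      have h3 : Matrix.mulVec (β.w s) (cd m) = (nstar ⬝ᵥ cd m) • ω := by
        funext p
        show β.w s p ⬝ᵥ cd m = ((nstar ⬝ᵥ cd m) • ω) p
        rw [Pi.smul_apply, smul_eq_mul, hW p, smul_dotProduct, smul_eq_mul, mul_comm]
      rw [h2, h3, dotProduct_smul, smul_eq_mul, mul_comm]
    rw [h1] at h
    rcases mul_eq_zero.mp h with h4 | h4
    · exact h4
    · exact absurd h4 hm
  have hα := PairingCR.eq_rep_or_neg_of_nu_dot ω d hω hαν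
  have hβ' := PairingCR.eq_rep_or_neg_of_nu_dot _ e hβ0 hβν
  exact PairingFactor.Q_eq_pair_or_neg Y (Matrix.of fun p i => β.w s p i) (Matrix.of fun q jj => β.g t (Matrix.single q jj (1 : ZMod 3)))
    ω (Matrix.mulVec A u') (fun p q => hpair p q) d e hα hβ'
where
  /-- `(y₀•b₀ + y₁•b₁)`-pairing helper. -/
  dotProduct_add_of_two (y : Fin 2 → ZMod 3) (b : Fin 2 → (Fin n → ZMod 3)) (v : Fin n → ZMod 3) :
      v ⬝ᵥ (∑ l, y l • b l) = y 0 * (v ⬝ᵥ b 0) + y 1 * (v ⬝ᵥ b 1) := by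
    rw [Fin.sum_univ_two, dotProduct_add, dotProduct_smul, dotProduct_smul, smul_eq_mul, smul_eq_mul]

end PairingRR

namespace PairingCC

/-- **(C, C) entry.** -/
theorem Q_eq_pair_or_neg (β : BilinComp (mulBilin (ZMod 3) 2 2 n) ι) (Y : Matrix (Fin 2) (Fin 2) (ZMod 3)) (s t : ι)
    (b : Fin 2 → (Fin n → ZMod 3)) (Ω : Matrix (Fin 2) (Fin 2) (ZMod 3)) (hW : ∀ p, β.w s p = ∑ l, Ω p l • b l) (hΩ : Ω.det ≠ 0)
    (cstar : Fin n → ZMod 3) (η : Fin 2 → ZMod 3) (hG : ∀ q, (fun jj => β.g t (Matrix.single q jj (1 : ZMod 3))) = η q • cstar) (hη : η ≠ 0)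
    (hu : ∃ l, b l ⬝ᵥ cstar ≠ 0)
    (c : Fin 2 → (Fin n → ZMod 3)) (x : Fin 2 → ZMod 3) (hxc : cstar = ∑ l, x l • c l)
    (d : Fin 4) (hcheapW : ∀ m, ∑ i, c m i * (Matrix.vecMul (![-((![![1, 0], ![0, 1], ![1, 1], ![1, 2]] : Fin 4 → Fin 2 → ZMod 3) d 1), (![![1, 0], ![0, 1], ![1, 1], ![1, 2]] : Fin 4 → Fin 2 → ZMod 3) d 0] : Fin 2 → ZMod 3) (β.w s)) i = 0)
    (be : Fin 2 → (Fin n → ZMod 3)) (e : Fin 4) (hcheapG : ∀ m, β.g t (Matrix.vecMulVec (![-((![![1, 0], ![0, 1], ![1, 1], ![1, 2]] : Fin 4 → Fin 2 → ZMod 3) e 1), (![![1, 0], ![0, 1], ![1, 1], ![1, 2]] : Fin 4 → Fin 2 → ZMod 3) e 0] : Fin 2 → ZMod 3) (be m)) = 0)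
    (hne : ∃ m, cstar ⬝ᵥ be m ≠ 0) :
    (∑ p, ∑ q, Y q p * (β.w s p ⬝ᵥ (fun jj => β.g t (Matrix.single q jj (1 : ZMod 3))))) = ∑ p, ∑ q, Y q p * ((![![1, 0], ![0, 1], ![1, 1], ![1, 2]] : Fin 4 → Fin 2 → ZMod 3) d p * (![![1, 0], ![0, 1], ![1, 1], ![1, 2]] : Fin 4 → Fin 2 → ZMod 3) e q) ∨
    (∑ p, ∑ q, Y q p * (β.w s p ⬝ᵥ (fun jj => β.g t (Matrix.single q jj (1 : ZMod 3))))) = -∑ p, ∑ q, Y q p * ((![![1, 0], ![0, 1], ![1, 1], ![1, 2]] : Fin 4 → Fin 2 → ZMod 3) d p * (![![1, 0], ![0, 1], ![1, 1], ![1, 2]] : Fin 4 → Fin 2 → ZMod 3) e q) := by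
  classical
  -- α-vector: z p := W_s p ⬝ c⋆ = (Ω u) p
  set u : Fin 2 → ZMod 3 := fun l => b l ⬝ᵥ cstar with hu_def
  have hmv : ∀ p, Matrix.mulVec Ω u p = Ω p 0 * (b 0 ⬝ᵥ cstar) + Ω p 1 * (b 1 ⬝ᵥ cstar) := by
    intro p; simp [Matrix.mulVec, dotProduct, Fin.sum_univ_two, hu_def]
  have hz : ∀ p, β.w s p ⬝ᵥ cstar = Matrix.mulVec Ω u p := by
    intro p
    rw [hW p, Fin.sum_univ_two, add_dotProduct, smul_dotProduct, smul_dotProduct, smul_eq_mul, smul_eq_mul, hmv p]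
  have hpair : ∀ p q, β.w s p ⬝ᵥ (fun jj => β.g t (Matrix.single q jj (1 : ZMod 3))) = Matrix.mulVec Ω u p * η q := by
    intro p q; rw [hG q, dotProduct_smul, smul_eq_mul, hz p, mul_comm]
  have hu0 : u ≠ 0 := by
    obtain ⟨l, hl⟩ := hu
    exact Function.ne_iff.mpr ⟨l, by rw [hu_def]; exact hl⟩
  have hα0 : Matrix.mulVec Ω u ≠ 0 := fun h => hu0 (Matrix.eq_zero_of_mulVec_eq_zero hΩ h)
  -- α ⊥ ν_d : cheapness of s for row d, with c⋆ ∈ span(c)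
  have hαν : (![-((![![1, 0], ![0, 1], ![1, 1], ![1, 2]] : Fin 4 → Fin 2 → ZMod 3) d 1), (![![1, 0], ![0, 1], ![1, 1], ![1, 2]] : Fin 4 → Fin 2 → ZMod 3) d 0] : Fin 2 → ZMod 3) ⬝ᵥ Matrix.mulVec Ω u = 0 := by
    have h2 : ∀ m, (![-((![![1, 0], ![0, 1], ![1, 1], ![1, 2]] : Fin 4 → Fin 2 → ZMod 3) d 1), (![![1, 0], ![0, 1], ![1, 1], ![1, 2]] : Fin 4 → Fin 2 → ZMod 3) d 0] : Fin 2 → ZMod 3) ⬝ᵥ Matrix.mulVec (β.w s) (c m) = 0 := by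
      intro m; rw [Matrix.dotProduct_mulVec, dotProduct_comm]; exact hcheapW m
    have h3 : Matrix.mulVec (β.w s) cstar = Matrix.mulVec Ω u := by
      funext p; exact hz p
    have h4 : Matrix.mulVec (β.w s) cstar = x 0 • Matrix.mulVec (β.w s) (c 0) + x 1 • Matrix.mulVec (β.w s) (c 1) := by
      rw [hxc, Fin.sum_univ_two, Matrix.mulVec_add, Matrix.mulVec_smul, Matrix.mulVec_smul]
    rw [← h3, h4, dotProduct_add, dotProduct_smul, dotProduct_smul, h2 0, h2 1, smul_zero, smul_zero, add_zero]
  -- β = η ⊥ ν_e : cheapness of t for column e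
  have hβν : (![-((![![1, 0], ![0, 1], ![1, 1], ![1, 2]] : Fin 4 → Fin 2 → ZMod 3) e 1), (![![1, 0], ![0, 1], ![1, 1], ![1, 2]] : Fin 4 → Fin 2 → ZMod 3) e 0] : Fin 2 → ZMod 3) ⬝ᵥ η = 0 := by
    obtain ⟨m, hm⟩ := hne
    have h := hcheapG m
    rw [DoubleCellKill.g_vecMulVec_eq_combo_dot, Fin.sum_univ_two, hG 0, hG 1, add_dotProduct, smul_dotProduct, smul_dotProduct,
      smul_dotProduct, smul_dotProduct] at h
    simp only [smul_eq_mul] at h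
    have h1 : ((![-((![![1, 0], ![0, 1], ![1, 1], ![1, 2]] : Fin 4 → Fin 2 → ZMod 3) e 1), (![![1, 0], ![0, 1], ![1, 1], ![1, 2]] : Fin 4 → Fin 2 → ZMod 3) e 0] : Fin 2 → ZMod 3) ⬝ᵥ η) * (cstar ⬝ᵥ be m) = 0 := by
      generalize cstar ⬝ᵥ be m = K at h ⊢
      rw [dotProduct, Fin.sum_univ_two]
      linear_combination h
    rcases mul_eq_zero.mp h1 with h4 | h4
    · exact h4
    · exact absurd h4 hm
  have hα := PairingCR.eq_rep_or_neg_of_nu_dot _ d hα0 hαν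
  have hβ' := PairingCR.eq_rep_or_neg_of_nu_dot η e hη hβν
  exact PairingFactor.Q_eq_pair_or_neg Y (Matrix.of fun p i => β.w s p i) (Matrix.of fun q jj => β.g t (Matrix.single q jj (1 : ZMod 3)))
    (Matrix.mulVec Ω u) η (fun p q => hpair p q) d e hα hβ'

end PairingCC

end Summit.MatrixMultiplication.OmegaCensus.SmallFormats
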